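import Summits.Ventures.HodgeRepro0.P5I4CensusPieces

/-!
# P5I4CensusCount — the balanced subsets of `(ℤ/32)^×` for the CM type of the instance I-4 number `18² = 324`
(kernel-checked)

p5 (g21), 2026-08-29.  Supporting artefact (R-5): finite combinatorics only; nothing here is an algebraicity statement.
Companion of `P5I4Census.lean` / `P5I4CensusPieces.lean`, whose notation it continues.

THEOREM `card_balanced`: the balanced subsets of `U = (ℤ/32)^×` number `324 = 18²`.  PROOF: by the block theorem a
balanced set is cut into its two block pieces `S ∩ block (crep i)`, each one of the 18 ALLOWED pieces of its block (the
16 unions of the block's four conjugate pairs and its two cosets — `allowed_card`, a `decide` over the 256 subsets of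
each block), and gluing two allowed pieces gives back a balanced set (`cut` / `glue`, a bijection onto
`Fintype.piFinset`).  The counts by size (8, 32, 72, 98, 72, 32, 8, 1)
are the coefficients of `(1 + 4z² + 8z⁴ + 4z⁶ + z⁸)²`; only the total is certified here.
-/

namespace HodgeRepro0.P5I4Census

/-- The allowed pieces on the block of `c`: the subsets of the block that are a union of conjugate pairs, the coset
`cH`, or the coset `−cH`. -/
def allowed (c : ℕ) : Finset (Finset ℕ) :=
  (block c).powerset.filter (fun P => PairsOn P c ∨ CosetOn P c ∨ ConjCosetOn P c)

/-- Each block carries exactly 18 allowed pieces (the 16 unions of its four conjugate pairs and its two cosets). -/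
theorem allowed_card : ∀ i : Fin 2, (allowed (crep i)).card = 18 := by decide +kernel

/-- The trichotomy on the block of `c` depends only on `S ∩ block c`. -/
theorem tri_inter (i : Fin 2) (S : Finset ℕ) :
    (PairsOn (S ∩ block (crep i)) (crep i) ↔ PairsOn S (crep i)) ∧
    (CosetOn (S ∩ block (crep i)) (crep i) ↔ CosetOn S (crep i)) ∧
    (ConjCosetOn (S ∩ block (crep i)) (crep i) ↔ ConjCosetOn S (crep i)) := by
  unfold PairsOn CosetOn ConjCosetOn
  refine ⟨?_, ?_, ?_⟩ <;> apply forall_congr' <;> intro t <;> apply imp_congr_right <;> intro ht <;>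
    simp [Finset.mem_inter, (block_mem i t ht).1, (block_mem i t ht).2]

/-- The balanced subsets of `U`. -/
def balancedSets : Finset (Finset ℕ) := U.powerset.filter Balanced

/-- The pieces: one allowed piece per block. -/
def pieces : Finset (Fin 2 → Finset ℕ) := Fintype.piFinset (fun i => allowed (crep i))

/-- Cut a set into its two block pieces. -/
def cut (S : Finset ℕ) : Fin 2 → Finset ℕ := fun i => S ∩ block (crep i)

/-- Glue two pieces. -/
def glue (P : Fin 2 → Finset ℕ) : Finset ℕ := Finset.univ.biUnion P

/-- Membership in a glued set, for a point of the `i`-th block, is membership in the `i`-th piece. -/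
theorem mem_glue (P : Fin 2 → Finset ℕ) (hP : P ∈ pieces) (i : Fin 2) (t : ℕ) (ht : t ∈ block (crep i)) :
    t ∈ glue P ↔ t ∈ P i := by
  unfold glue
  rw [Finset.mem_biUnion]
  constructor
  · rintro ⟨j, _, hj⟩
    by_cases hij : j = i
    · rw [← hij]; exact hj
    · exfalso
      have hPj : P j ⊆ block (crep j) := Finset.mem_powerset.mp (Finset.mem_filter.mp (Fintype.mem_piFinset.mp hP j)).1
      exact block_disj j i hij t (hPj hj) ht
  · intro h; exact ⟨i, Finset.mem_univ i, h⟩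

/-- `cut` maps balanced sets to pieces. -/
theorem cut_mem (S : Finset ℕ) (hS : S ∈ balancedSets) : cut S ∈ pieces := by
  unfold balancedSets at hS
  rw [Finset.mem_filter, Finset.mem_powerset] at hS
  obtain ⟨hSU, hb⟩ := hS
  rw [pieces, Fintype.mem_piFinset]
  intro i
  unfold allowed
  rw [Finset.mem_filter, Finset.mem_powerset]
  refine ⟨Finset.inter_subset_right, ?_⟩
  have h := (balanced_iff_blocks S hSU).mp hb (crep i) (crep_facts.1 i)
  obtain ⟨h1, h2, h3⟩ := tri_inter i S
  unfold cut
  rw [h1, h2, h3]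
  exact h

/-- `glue` maps pieces to balanced sets. -/
theorem glue_mem (P : Fin 2 → Finset ℕ) (hP : P ∈ pieces) : glue P ∈ balancedSets := by
  have hPi : ∀ i, P i ⊆ block (crep i) := fun i =>
    Finset.mem_powerset.mp (Finset.mem_filter.mp (Fintype.mem_piFinset.mp hP i)).1
  have hsub : glue P ⊆ U := by
    intro t ht
    unfold glue at ht
    rw [Finset.mem_biUnion] at ht
    obtain ⟨j, _, hj⟩ := ht
    exact block_cover.2 j (hPi j hj)
  unfold balancedSets
  rw [Finset.mem_filter, Finset.mem_powerset]
  refine ⟨hsub, ?_⟩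
  rw [balanced_iff_blocks _ hsub]
  intro c hc
  obtain ⟨i, rfl⟩ := crep_facts.2 c hc
  have htri := (Finset.mem_filter.mp (Fintype.mem_piFinset.mp hP i)).2
  have key : ∀ t ∈ coset (crep i), (t ∈ glue P ↔ t ∈ P i) ∧ (conj t ∈ glue P ↔ conj t ∈ P i) := by
    intro t ht
    exact ⟨mem_glue P hP i t (block_mem i t ht).1, mem_glue P hP i (conj t) (block_mem i t ht).2⟩
  unfold PairsOn CosetOn ConjCosetOn at htri ⊢
  rcases htri with h | h | h
  · left; intro t ht; rw [(key t ht).1, (key t ht).2]; exact h t ht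
  · right; left; intro t ht; rw [(key t ht).1, (key t ht).2]; exact h t ht
  · right; right; intro t ht; rw [(key t ht).1, (key t ht).2]; exact h t ht

/-- `glue ∘ cut = id` on subsets of `U`. -/
theorem glue_cut (S : Finset ℕ) (hS : S ∈ balancedSets) : glue (cut S) = S := by
  have hSU : S ⊆ U := Finset.mem_powerset.mp (Finset.mem_filter.mp hS).1
  ext t
  unfold glue cut
  rw [Finset.mem_biUnion]
  constructor
  · rintro ⟨i, _, hi⟩; exact (Finset.mem_inter.mp hi).1
  · intro ht
    obtain ⟨i, hi⟩ := block_cover.1 t (List.mem_toFinset.mp (hSU ht))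
    exact ⟨i, Finset.mem_univ i, Finset.mem_inter.mpr ⟨ht, hi⟩⟩

/-- `cut ∘ glue = id` on pieces. -/
theorem cut_glue (P : Fin 2 → Finset ℕ) (hP : P ∈ pieces) : cut (glue P) = P := by
  have hPi : ∀ i, P i ⊆ block (crep i) := fun i =>
    Finset.mem_powerset.mp (Finset.mem_filter.mp (Fintype.mem_piFinset.mp hP i)).1
  funext i
  ext t
  unfold cut
  rw [Finset.mem_inter]
  constructor
  · rintro ⟨h1, h2⟩; exact (mem_glue P hP i t h2).mp h1
  · intro h; exact ⟨(mem_glue P hP i t (hPi i h)).mpr h, hPi i h⟩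

/-- THE COUNT: the balanced subsets of `(ℤ/32)^×` for the CM type `Φ` of I-4 number `18² = 324`. -/
theorem card_balanced : balancedSets.card = 324 := by
  rw [Finset.card_nbij' cut glue cut_mem glue_mem glue_cut cut_glue]
  unfold pieces
  rw [Fintype.card_piFinset]
  simp [allowed_card]


end HodgeRepro0.P5I4Census
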